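import Summits.NavierStokesRegularity.FluidComputer.GateBudgetEnvelope
import Summits.NavierStokesRegularity.FluidComputer.GateBudgetAfterglow
import Summits.NavierStokesRegularity.FluidComputer.GateBudgetDrain
import Summits.NavierStokesRegularity.FluidComputer.RotorKnobNecessity
import HarnessLib

/-!
# What no tuning can beat, part 9: the envelope law for the five-gate circuit and the knob family

Cell `pub-fluidc`, blueprint seat bp1 (gen 25); ONE text with part 8 (`GateBudgetEnvelope.lean`, the
abstract planar device), split by the 400-line rule; namespace
`Summit.NavierStokesRegularity.FluidComputer.GateBudget`. HONEST FRAMING (verbatim): low prior, high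
value-of-information experiment on Tao's machine paradigm; NOT a claim that NS blows up. Five-mode
ODEs only (Tao's (5.5)/(5.6) of [Tao2016AveragedNS, §5.5] and the coupling families of parts 1–7 and
gen 20); nothing is proved about the Navier–Stokes equations.

## Contents

* §20 the carrier pair `(a,d) = (X 0, X 3)` of `fiveGateCircuit ε σ μ R K` is a planar rotation at
  speed `ω = Rc` with friction `p = εb + σc` on `a` and the drain `γ = Kã` on `d`
  (`hasDerivAt_d`); the CRUDE bounds `e^{-2(εb₁+σ+K)Δt} ≤ E(t)/E(s) ≤ e^{2(εb₁+σ)Δt}`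
  (`carrier_crude_lower/upper`, every coupling, every window in `[0,∞)` with `|b| ≤ b₁`); the
  constants of the tilt `κ = Kã/(Rc)` on a window where `c ≥ c₀ > 0`, `Rc ≥ λ > 0`
  (`carrier_consts`); THE ENVELOPE LAW `carrier_envelope_upper/lower` (two-sided, rate `∫Kã`,
  prefactors `(1 ± κ₁/2)/(1 ∓ κ₁/2)`, `κ₁ = K/λ ≤ 1`, rate error
  `δ ≤ 4p₁ + k`, `p₁ = εb₁ + σ`, `k = (K/λ)(p₁ + K + σ/c₀ + μb₁)`), and its floor / ceiling forms
  `E(t) ≤ 3e^{-(Kθ₀ - 4p₁ - k)(t-T₁)}E(T₁)` (`ã ≥ θ₀`), `E(t) ≥ ⅓e^{-(Kθ₁ + 4p₁ + k)(t-T₁)}E(T₁)`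
  (`ã ≤ θ₁`).
* §21 the same for gen 20's two-scale family `RotorKnob.rotorCircuit K M ε ρ` (clock `ε`, amplifier
  `ε⁻¹M`, seed `ρ²e^{-M}`, rotor `ρ⁻²`, drain `K`): on a window where the trigger over-turns drain
  and sweep, `c/ρ² ≥ λ ≥ max(K,1)`, with `ρ² ≤ ε ≤ 1`, `M ≥ 0`, the clock budget `|b| ≤ 2εT₂` of
  part 1 makes every constant explicit: rate error `η = 8ε²T₂ + 4εe^{-M} + (K/λ)(K + 2(M+1)T₂ + 2)`
  (`knob_rate_error_le`, `rotorKnob_carrier_envelope`, `rotorKnob_carrier_ceiling`).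

Not valid near the rotor stop `Rc ~ K` (there only the crude bounds hold); not a necessity theorem
for firing. [cite: Tao2016AveragedNS, §5.5 (5.5), (5.6), Theorem 5.3 and its proof: (energy-con),
(est), (ob-2)]. Theorems only; no named facts; 0 sorry.
-/

noncomputable section

namespace Summit.NavierStokesRegularity.FluidComputer.GateBudget

open Real Set Filter Topology
open Literature.Analysis.FluidPDE.Tao2016AveragedNS
open Literature.Analysis.FluidPDE.Tao2016AveragedNS.Thm53 (antitoneOn_intFactor monotoneOn_intFactor
  antitoneOn_sub_of_deriv_le monotoneOn_sub_of_le_deriv init_a init_b init_c init_d init_e)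

variable {ε σ μ R K : ℝ} {X : ℝ → Fin 5 → ℝ}

/-! ## §20 The carrier pair of the five-gate circuit -/

/-- (d-eq): `∂ₜd = Rca - Kdã`. [cite: Tao2016AveragedNS, §5.5 (5.5)] -/
theorem hasDerivAt_d (hX : ∀ t, HasDerivAt X (fiveGateCircuit ε σ μ R K (X t)) t) (t : ℝ) :
    HasDerivAt (fun s => X s 3) (R * X t 2 * X t 0 - K * X t 3 * X t 4) t :=
  (hasDerivAt_pi.1 (hX t) 3).congr_deriv (by simp [fiveGateCircuit])

/-- Friction and drain of the carrier pair are bounded: `|εb + σc| ≤ εb₁ + σ`, `0 ≤ Kã ≤ K` for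
`t ≥ 0` (`ε, σ, K ≥ 0`, `|b| ≤ b₁`, `|c|, ã ≤ 1`, `ã ≥ 0`). [cite: Tao2016AveragedNS, §5.5 (est)] -/
theorem carrier_friction (hX : ∀ t, HasDerivAt X (fiveGateCircuit ε σ μ R K (X t)) t)
    (h0 : X 0 = delayInit) (hε : 0 ≤ ε) (hσ : 0 ≤ σ) (hK : 0 ≤ K) {t b₁ : ℝ} (ht : 0 ≤ t)
    (hb : |X t 1| ≤ b₁) :
    |ε * X t 1 + σ * X t 2| ≤ ε * b₁ + σ ∧ 0 ≤ K * X t 4 ∧ K * X t 4 ≤ K := by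
  have hc := (abs_le.1 (traj_abs_le_one hX h0 t 2))
  have he := (abs_le.1 (traj_abs_le_one hX h0 t 4)).2
  refine ⟨(abs_add_le _ _).trans ?_, mul_nonneg hK (e_nonneg hX h0 hK ht),
    mul_le_of_le_one_right hK he⟩
  rw [abs_mul, abs_mul, abs_of_nonneg hε, abs_of_nonneg hσ]
  nlinarith [mul_le_mul_of_nonneg_left hb hε,
    mul_le_mul_of_nonneg_left (traj_abs_le_one hX h0 t 2) hσ]

/-- **CRUDE LOWER BOUND for the carrier (the drain ceiling; every coupling, valid through the rotor
stop).** `e^{-2(εb₁+σ+K)(t-s)}·E(s) ≤ E(t)`, `E = a² + d²`, for `0 ≤ s ≤ t` with `|b| ≤ b₁` on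
`[s,t]`:
clock, seed and drain together cannot remove the carrier faster than rate `2(εb₁ + σ + K)`.
[cite: Tao2016AveragedNS, §5.5 (5.5), (est)] -/
theorem carrier_crude_lower (hX : ∀ t, HasDerivAt X (fiveGateCircuit ε σ μ R K (X t)) t)
    (h0 : X 0 = delayInit) (hε : 0 ≤ ε) (hσ : 0 ≤ σ) (hK : 0 ≤ K) {s t b₁ : ℝ} (hs : 0 ≤ s)
    (hst : s ≤ t) (hb : ∀ r ∈ Icc s t, |X r 1| ≤ b₁) :
    exp (-(2 * (ε * b₁ + σ + K) * (t - s))) * (X s 0 ^ 2 + X s 3 ^ 2) ≤ X t 0 ^ 2 + X t 3 ^ 2 :=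
  pairEnergy_crude_lower (a := fun r => X r 0) (d := fun r => X r 3) (ω := fun r => R * X r 2)
    (p := fun r => ε * X r 1 + σ * X r 2) (γ := fun r => K * X r 4)
    (fun r _ => (hasDerivAt_a hX r).congr_deriv (by ring))
    (fun r _ => (hasDerivAt_d hX r).congr_deriv (by ring))
    (fun r hr => (carrier_friction hX h0 hε hσ hK (hs.trans hr.1) (hb r hr)).1)
    (fun r hr => (carrier_friction hX h0 hε hσ hK (hs.trans hr.1) (hb r hr)).2.1)
    (fun r hr => (carrier_friction hX h0 hε hσ hK (hs.trans hr.1) (hb r hr)).2.2)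
    (right_mem_Icc.2 hst)

/-- **CRUDE UPPER BOUND for the carrier.** `E(t) ≤ e^{2(εb₁+σ)(t-s)}·E(s)` for `0 ≤ s ≤ t`: only the
clock and the seed can feed the carrier back. [cite: Tao2016AveragedNS, §5.5 (5.5), (est)] -/
theorem carrier_crude_upper (hX : ∀ t, HasDerivAt X (fiveGateCircuit ε σ μ R K (X t)) t)
    (h0 : X 0 = delayInit) (hε : 0 ≤ ε) (hσ : 0 ≤ σ) (hK : 0 ≤ K) {s t b₁ : ℝ} (hs : 0 ≤ s)
    (hst : s ≤ t) (hb : ∀ r ∈ Icc s t, |X r 1| ≤ b₁) :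
    X t 0 ^ 2 + X t 3 ^ 2 ≤ exp (2 * (ε * b₁ + σ) * (t - s)) * (X s 0 ^ 2 + X s 3 ^ 2) :=
  pairEnergy_crude_upper (a := fun r => X r 0) (d := fun r => X r 3) (ω := fun r => R * X r 2)
    (p := fun r => ε * X r 1 + σ * X r 2) (γ := fun r => K * X r 4)
    (fun r _ => (hasDerivAt_a hX r).congr_deriv (by ring))
    (fun r _ => (hasDerivAt_d hX r).congr_deriv (by ring))
    (fun r hr => (carrier_friction hX h0 hε hσ hK (hs.trans hr.1) (hb r hr)).1)
    (fun r hr => (carrier_friction hX h0 hε hσ hK (hs.trans hr.1) (hb r hr)).2.1)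
    (right_mem_Icc.2 hst)

/-- **THE ENVELOPE LAW for the five-gate circuit, upper side.** Along an exact trajectory of
`fiveGateCircuit ε σ μ R K` from (5.6) (`ε, σ, μ, K ≥ 0`), on a window `[T₁,T₂] ⊆ [0,∞)` on which
`c ≥ c₀ > 0`, `Rc ≥ λ > 0`, `λ ≥ K` and `|b| ≤ b₁`, for every primitive `Γ' = Kã`:
`E(t) ≤ (1+κ₁/2)/(1-κ₁/2)·exp(-(Γ(t)-Γ(T₁)) + δ(t-T₁))·E(T₁)`, `E = a² + d²`, `κ₁ = K/λ`,
`δ = (2p₁ + k/2)/(1-κ₁/2)`, `p₁ = εb₁ + σ`, `k = (K/λ)(p₁ + K + σ/c₀ + μb₁)`.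
[cite: Tao2016AveragedNS, §5.5 (5.5), (5.6), (est)] -/
theorem carrier_envelope_upper (hX : ∀ t, HasDerivAt X (fiveGateCircuit ε σ μ R K (X t)) t)
    (h0 : X 0 = delayInit) (hε : 0 ≤ ε) (hσ : 0 ≤ σ) (hμ : 0 ≤ μ) (hK : 0 ≤ K)
    {T₁ T₂ c₀ lam b₁ : ℝ} {Γ : ℝ → ℝ} (hT₁ : 0 ≤ T₁) (hc₀ : 0 < c₀) (hlam : 0 < lam)
    (hKl : K ≤ lam) (hc : ∀ t ∈ Icc T₁ T₂, c₀ ≤ X t 2) (hRc : ∀ t ∈ Icc T₁ T₂, lam ≤ R * X t 2)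
    (hb : ∀ t ∈ Icc T₁ T₂, |X t 1| ≤ b₁) (hΓ : ∀ t ∈ Icc T₁ T₂, HasDerivAt Γ (K * X t 4) t)
    {t : ℝ} (ht : t ∈ Icc T₁ T₂) :
    X t 0 ^ 2 + X t 3 ^ 2 ≤ (1 + K / lam / 2) / (1 - K / lam / 2)
      * exp (-(Γ t - Γ T₁) + (2 * (ε * b₁ + σ)
          + K / lam * (ε * b₁ + σ + K + σ / c₀ + μ * b₁) / 2) / (1 - K / lam / 2) * (t - T₁))
      * (X T₁ 0 ^ 2 + X T₁ 3 ^ 2) := by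
  have hκ₁ : K / lam < 2 := ((div_le_one hlam).2 hKl).trans_lt (by norm_num)
  have hC := fun r (hr : r ∈ Icc T₁ T₂) => carrier_consts (R := R) hε hσ hμ hK hc₀ hlam
    (traj_sq_le_one hX h0 r 0) (hb r hr) (hc r hr) (abs_le.1 (traj_abs_le_one hX h0 r 2)).2
    (traj_sq_le_one hX h0 r 3) (e_nonneg hX h0 hK (hT₁.trans hr.1))
    (abs_le.1 (traj_abs_le_one hX h0 r 4)).2 (hRc r hr)
  exact pair_envelope_upper (a := fun s => X s 0) (d := fun s => X s 3) (ω := fun s => R * X s 2)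
    (p := fun s => ε * X s 1 + σ * X s 2) (γ := fun s => K * X s 4)
    (κ := fun s => K * X s 4 / (R * X s 2))
    (κ' := fun s => (K * (K * X s 3 ^ 2) * (R * X s 2)
      - K * X s 4 * (R * (σ * X s 0 ^ 2 + μ * X s 1 * X s 2))) / (R * X s 2) ^ 2)
    hκ₁ (fun r _ => (hasDerivAt_a hX r).congr_deriv (by ring))
    (fun r _ => (hasDerivAt_d hX r).congr_deriv (by ring))
    (fun r hr => ((hasDerivAt_e hX r).const_mul K).div ((hasDerivAt_c hX r).const_mul R)
      (hlam.trans_le (hRc r hr)).ne')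
    hΓ (fun r hr => (hC r hr).2.2.1) (fun r hr => (hC r hr).1) (fun r hr => (hC r hr).2.1)
    (fun r hr => (hC r hr).2.2.2.1) (fun r hr => (hC r hr).2.2.2.2) ht

/-- **THE ENVELOPE LAW for the five-gate circuit, lower side.** Same hypotheses:
`(1-κ₁/2)/(1+κ₁/2)·exp(-(Γ(t)-Γ(T₁)) - δ(t-T₁))·E(T₁) ≤ E(t)`.
[cite: Tao2016AveragedNS, §5.5 (5.5), (5.6), (est)] -/
theorem carrier_envelope_lower (hX : ∀ t, HasDerivAt X (fiveGateCircuit ε σ μ R K (X t)) t)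
    (h0 : X 0 = delayInit) (hε : 0 ≤ ε) (hσ : 0 ≤ σ) (hμ : 0 ≤ μ) (hK : 0 ≤ K)
    {T₁ T₂ c₀ lam b₁ : ℝ} {Γ : ℝ → ℝ} (hT₁ : 0 ≤ T₁) (hc₀ : 0 < c₀) (hlam : 0 < lam)
    (hKl : K ≤ lam) (hc : ∀ t ∈ Icc T₁ T₂, c₀ ≤ X t 2) (hRc : ∀ t ∈ Icc T₁ T₂, lam ≤ R * X t 2)
    (hb : ∀ t ∈ Icc T₁ T₂, |X t 1| ≤ b₁) (hΓ : ∀ t ∈ Icc T₁ T₂, HasDerivAt Γ (K * X t 4) t)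
    {t : ℝ} (ht : t ∈ Icc T₁ T₂) :
    (1 - K / lam / 2) / (1 + K / lam / 2)
      * exp (-(Γ t - Γ T₁) - (2 * (ε * b₁ + σ)
          + K / lam * (ε * b₁ + σ + K + σ / c₀ + μ * b₁) / 2) / (1 - K / lam / 2) * (t - T₁))
      * (X T₁ 0 ^ 2 + X T₁ 3 ^ 2) ≤ X t 0 ^ 2 + X t 3 ^ 2 := by
  have hκ₁ : K / lam < 2 := ((div_le_one hlam).2 hKl).trans_lt (by norm_num)
  have hC := fun r (hr : r ∈ Icc T₁ T₂) => carrier_consts (R := R) hε hσ hμ hK hc₀ hlam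
    (traj_sq_le_one hX h0 r 0) (hb r hr) (hc r hr) (abs_le.1 (traj_abs_le_one hX h0 r 2)).2
    (traj_sq_le_one hX h0 r 3) (e_nonneg hX h0 hK (hT₁.trans hr.1))
    (abs_le.1 (traj_abs_le_one hX h0 r 4)).2 (hRc r hr)
  exact pair_envelope_lower (a := fun s => X s 0) (d := fun s => X s 3) (ω := fun s => R * X s 2)
    (p := fun s => ε * X s 1 + σ * X s 2) (γ := fun s => K * X s 4)
    (κ := fun s => K * X s 4 / (R * X s 2))
    (κ' := fun s => (K * (K * X s 3 ^ 2) * (R * X s 2)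
      - K * X s 4 * (R * (σ * X s 0 ^ 2 + μ * X s 1 * X s 2))) / (R * X s 2) ^ 2)
    hκ₁ (fun r _ => (hasDerivAt_a hX r).congr_deriv (by ring))
    (fun r _ => (hasDerivAt_d hX r).congr_deriv (by ring))
    (fun r hr => ((hasDerivAt_e hX r).const_mul K).div ((hasDerivAt_c hX r).const_mul R)
      (hlam.trans_le (hRc r hr)).ne')
    hΓ (fun r hr => (hC r hr).2.2.1) (fun r hr => (hC r hr).1) (fun r hr => (hC r hr).2.1)
    (fun r hr => (hC r hr).2.2.2.1) (fun r hr => (hC r hr).2.2.2.2) ht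

/-- **THE ENVELOPE LAW with a floor.** If moreover `ã ≥ θ₀` on the window then
`E(t) ≤ 3·exp(-(Kθ₀ - (4p₁ + k))(t - T₁))·E(T₁)`: once the rotor over-turns the drain
(`Rc ≥ λ ≥ K`), the carrier is drained at rate at least `Kθ₀ - 4p₁ - k`.
[cite: Tao2016AveragedNS, §5.5 (5.5), (5.6), (est)] -/
theorem carrier_envelope_floor (hX : ∀ t, HasDerivAt X (fiveGateCircuit ε σ μ R K (X t)) t)
    (h0 : X 0 = delayInit) (hε : 0 ≤ ε) (hσ : 0 ≤ σ) (hμ : 0 ≤ μ) (hK : 0 ≤ K)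
    {T₁ T₂ c₀ lam b₁ θ₀ : ℝ} (hT₁ : 0 ≤ T₁) (hc₀ : 0 < c₀) (hlam : 0 < lam) (hKl : K ≤ lam)
    (hc : ∀ t ∈ Icc T₁ T₂, c₀ ≤ X t 2) (hRc : ∀ t ∈ Icc T₁ T₂, lam ≤ R * X t 2)
    (hb : ∀ t ∈ Icc T₁ T₂, |X t 1| ≤ b₁) (he : ∀ t ∈ Icc T₁ T₂, θ₀ ≤ X t 4)
    {t : ℝ} (ht : t ∈ Icc T₁ T₂) :
    X t 0 ^ 2 + X t 3 ^ 2 ≤ 3 * exp (-((K * θ₀ - (4 * (ε * b₁ + σ)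
        + K / lam * (ε * b₁ + σ + K + σ / c₀ + μ * b₁))) * (t - T₁)))
      * (X T₁ 0 ^ 2 + X T₁ 3 ^ 2) := by
  have hT : T₁ ∈ Icc T₁ T₂ := left_mem_Icc.2 (ht.1.trans ht.2)
  set Γ : ℝ → ℝ := fun s => ∫ x in T₁..s, K * X x 4 with hΓ
  have hΓd : ∀ s, HasDerivAt Γ (K * X s 4) s := fun s =>
    ((continuous_const.mul (continuous_traj hX 4)).integral_hasStrictDerivAt T₁ s).hasDerivAt
  have h :=
    carrier_envelope_upper hX h0 hε hσ hμ hK hT₁ hc₀ hlam hKl hc hRc hb (fun s _ => hΓd s) ht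
  -- the primitive grows at least like `Kθ₀·t`
  have hmono := monotoneOn_sub_of_le_deriv (f := Γ) (f' := fun s => K * X s 4)
    (φ := fun _ => K * θ₀) (Φ := fun s => K * θ₀ * s) (convex_Icc T₁ T₂) (fun s _ => hΓd s)
    (fun s _ => ((hasDerivAt_id' s).const_mul _).congr_deriv (by simp))
    (fun s hs => mul_le_mul_of_nonneg_left (he s hs) hK)
  have hG := hmono hT ht ht.1
  dsimp only at hG
  set p₁ := ε * b₁ + σ with hp₁
  set k := K / lam * (ε * b₁ + σ + K + σ / c₀ + μ * b₁) with hk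
  set κ₁ := K / lam with hκ₁
  have hb0 : 0 ≤ b₁ := (abs_nonneg _).trans (hb t ht)
  have hp0 : 0 ≤ p₁ := by positivity
  have hk0 : 0 ≤ k := by positivity
  have hκ0 : 0 ≤ κ₁ := by positivity
  have hκle : κ₁ ≤ 1 := (div_le_one hlam).2 hKl
  have hm : 0 < 1 - κ₁ / 2 := by linarith
  have hA : (1 + κ₁ / 2) / (1 - κ₁ / 2) ≤ 3 := by rw [div_le_iff₀ hm]; linarith
  have hδ : (2 * p₁ + k / 2) / (1 - κ₁ / 2) ≤ 4 * p₁ + k := by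
    rw [div_le_iff₀ hm]
    nlinarith [mul_nonneg (by positivity : 0 ≤ 4 * p₁ + k) (by linarith : 0 ≤ 1 - κ₁)]
  have hΔ : 0 ≤ t - T₁ := by linarith [ht.1]
  have hexp : -(Γ t - Γ T₁) + (2 * p₁ + k / 2) / (1 - κ₁ / 2) * (t - T₁)
      ≤ -((K * θ₀ - (4 * p₁ + k)) * (t - T₁)) := by
    nlinarith [mul_le_mul_of_nonneg_right hδ hΔ]
  have hE : 0 ≤ X T₁ 0 ^ 2 + X T₁ 3 ^ 2 := by positivity
  calc X t 0 ^ 2 + X t 3 ^ 2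
      ≤ (1 + κ₁ / 2) / (1 - κ₁ / 2)
          * exp (-(Γ t - Γ T₁) + (2 * p₁ + k / 2) / (1 - κ₁ / 2) * (t - T₁))
          * (X T₁ 0 ^ 2 + X T₁ 3 ^ 2) := h
    _ ≤ 3 * exp (-((K * θ₀ - (4 * p₁ + k)) * (t - T₁))) * (X T₁ 0 ^ 2 + X T₁ 3 ^ 2) :=
        mul_le_mul_of_nonneg_right
          (mul_le_mul hA (exp_le_exp.2 hexp) (exp_pos _).le (by norm_num)) hE

/-- **THE ENVELOPE LAW with a ceiling (the drain is no faster than its average either).** If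
`ã ≤ θ₁` on the window then `E(t) ≥ ⅓·exp(-(Kθ₁ + 4p₁ + k)(t - T₁))·E(T₁)`.
[cite: Tao2016AveragedNS, §5.5 (5.5), (5.6), (est)] -/
theorem carrier_envelope_ceiling (hX : ∀ t, HasDerivAt X (fiveGateCircuit ε σ μ R K (X t)) t)
    (h0 : X 0 = delayInit) (hε : 0 ≤ ε) (hσ : 0 ≤ σ) (hμ : 0 ≤ μ) (hK : 0 ≤ K)
    {T₁ T₂ c₀ lam b₁ θ₁ : ℝ} (hT₁ : 0 ≤ T₁) (hc₀ : 0 < c₀) (hlam : 0 < lam) (hKl : K ≤ lam)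
    (hc : ∀ t ∈ Icc T₁ T₂, c₀ ≤ X t 2) (hRc : ∀ t ∈ Icc T₁ T₂, lam ≤ R * X t 2)
    (hb : ∀ t ∈ Icc T₁ T₂, |X t 1| ≤ b₁) (he : ∀ t ∈ Icc T₁ T₂, X t 4 ≤ θ₁)
    {t : ℝ} (ht : t ∈ Icc T₁ T₂) :
    1 / 3 * exp (-((K * θ₁ + (4 * (ε * b₁ + σ)
        + K / lam * (ε * b₁ + σ + K + σ / c₀ + μ * b₁))) * (t - T₁))) * (X T₁ 0 ^ 2 + X T₁ 3 ^ 2)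
      ≤ X t 0 ^ 2 + X t 3 ^ 2 := by
  have hT : T₁ ∈ Icc T₁ T₂ := left_mem_Icc.2 (ht.1.trans ht.2)
  set Γ : ℝ → ℝ := fun s => ∫ x in T₁..s, K * X x 4 with hΓ
  have hΓd : ∀ s, HasDerivAt Γ (K * X s 4) s := fun s =>
    ((continuous_const.mul (continuous_traj hX 4)).integral_hasStrictDerivAt T₁ s).hasDerivAt
  have h :=
    carrier_envelope_lower hX h0 hε hσ hμ hK hT₁ hc₀ hlam hKl hc hRc hb (fun s _ => hΓd s) ht
  have hanti := antitoneOn_sub_of_deriv_le (f := Γ) (f' := fun s => K * X s 4)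
    (φ := fun _ => K * θ₁) (Φ := fun s => K * θ₁ * s) (convex_Icc T₁ T₂) (fun s _ => hΓd s)
    (fun s _ => ((hasDerivAt_id' s).const_mul _).congr_deriv (by simp))
    (fun s hs => mul_le_mul_of_nonneg_left (he s hs) hK)
  have hG := hanti hT ht ht.1
  dsimp only at hG
  set p₁ := ε * b₁ + σ with hp₁
  set k := K / lam * (ε * b₁ + σ + K + σ / c₀ + μ * b₁) with hk
  set κ₁ := K / lam with hκ₁
  have hb0 : 0 ≤ b₁ := (abs_nonneg _).trans (hb t ht)
  have hp0 : 0 ≤ p₁ := by positivity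
  have hk0 : 0 ≤ k := by positivity
  have hκ0 : 0 ≤ κ₁ := by positivity
  have hκle : κ₁ ≤ 1 := (div_le_one hlam).2 hKl
  have hm : 0 < 1 - κ₁ / 2 := by linarith
  have hM : 0 < 1 + κ₁ / 2 := by linarith
  have hA : 1 / 3 ≤ (1 - κ₁ / 2) / (1 + κ₁ / 2) := by rw [le_div_iff₀ hM]; linarith
  have hδ : (2 * p₁ + k / 2) / (1 - κ₁ / 2) ≤ 4 * p₁ + k := by
    rw [div_le_iff₀ hm]
    nlinarith [mul_nonneg (by positivity : 0 ≤ 4 * p₁ + k) (by linarith : 0 ≤ 1 - κ₁)]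
  have hΔ : 0 ≤ t - T₁ := by linarith [ht.1]
  have hexp : -((K * θ₁ + (4 * p₁ + k)) * (t - T₁))
      ≤ -(Γ t - Γ T₁) - (2 * p₁ + k / 2) / (1 - κ₁ / 2) * (t - T₁) := by
    nlinarith [mul_le_mul_of_nonneg_right hδ hΔ]
  have hE : 0 ≤ X T₁ 0 ^ 2 + X T₁ 3 ^ 2 := by positivity
  calc 1 / 3 * exp (-((K * θ₁ + (4 * p₁ + k)) * (t - T₁))) * (X T₁ 0 ^ 2 + X T₁ 3 ^ 2)
      ≤ (1 - κ₁ / 2) / (1 + κ₁ / 2)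
          * exp (-(Γ t - Γ T₁) - (2 * p₁ + k / 2) / (1 - κ₁ / 2) * (t - T₁))
          * (X T₁ 0 ^ 2 + X T₁ 3 ^ 2) :=
        mul_le_mul_of_nonneg_right
          (mul_le_mul hA (exp_le_exp.2 hexp) (exp_pos _).le (by positivity)) hE
    _ ≤ X t 0 ^ 2 + X t 3 ^ 2 := h

/-! ## §21 The envelope law for the two-scale knob family `rotorCircuit K M ε ρ` -/

/-- The knob family's rate error: with `ρ² ≤ ε ≤ 1`, `M ≥ 0`, `K ≥ 0`, `λ ≥ 1`, `T₂ ≥ 0`, the clock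
budget `b₁ = (ε + ρ²e^{-M})T₂`, seed `σ = ρ²e^{-M}`, amplifier `μ = ε⁻¹M` and floor `c₀ = λρ²`:
`4p₁ + k ≤ η := 8ε²T₂ + 4εe^{-M} + (K/λ)(K + 2(M+1)T₂ + 2)`.
[cite: Tao2016AveragedNS, §5.5 (5.5)] -/
theorem knob_rate_error_le {K M ε ρ lam T₂ : ℝ} (hε : 0 < ε) (hε1 : ε ≤ 1) (hρ : 0 < ρ)
    (hρε : ρ ^ 2 ≤ ε) (hM : 0 ≤ M) (hK : 0 ≤ K) (hlam : 1 ≤ lam) (hT₂ : 0 ≤ T₂) :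
    4 * (ε * ((ε + ρ ^ 2 * exp (-M)) * T₂) + ρ ^ 2 * exp (-M))
      + K / lam * (ε * ((ε + ρ ^ 2 * exp (-M)) * T₂) + ρ ^ 2 * exp (-M) + K
          + ρ ^ 2 * exp (-M) / (lam * ρ ^ 2) + ε⁻¹ * M * ((ε + ρ ^ 2 * exp (-M)) * T₂))
      ≤ 8 * ε ^ 2 * T₂ + 4 * ε * exp (-M) + K / lam * (K + 2 * (M + 1) * T₂ + 2) := by
  have hex : exp (-M) ≤ 1 := exp_le_one_iff.2 (by linarith)
  have hex0 : 0 < exp (-M) := exp_pos _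
  have hρ2 : 0 < ρ ^ 2 := by positivity
  have hs : ρ ^ 2 * exp (-M) ≤ ε := by nlinarith
  have hs1 : ρ ^ 2 * exp (-M) ≤ ε * exp (-M) := mul_le_mul_of_nonneg_right hρε hex0.le
  have hl0 : 0 < lam := by linarith
  -- clock budget `b₁ ≤ 2εT₂`, sweep `μb₁ ≤ 2MT₂`, seed over floor `σ/c₀ = e^{-M}/λ ≤ 1`
  have hb₁ : (ε + ρ ^ 2 * exp (-M)) * T₂ ≤ 2 * ε * T₂ := by nlinarith
  have hμb : ε⁻¹ * M * ((ε + ρ ^ 2 * exp (-M)) * T₂) ≤ 2 * M * T₂ := by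
    have h1 : ε⁻¹ * (ε + ρ ^ 2 * exp (-M)) ≤ 2 := by
      rw [inv_mul_le_iff₀ hε]; linarith
    have : ε⁻¹ * M * ((ε + ρ ^ 2 * exp (-M)) * T₂) = M * T₂ * (ε⁻¹ * (ε + ρ ^ 2 * exp (-M))) := by
      ring
    rw [this]
    nlinarith [mul_nonneg hM hT₂]
  have hσc : ρ ^ 2 * exp (-M) / (lam * ρ ^ 2) ≤ 1 := by
    rw [div_le_one (by positivity)]; nlinarith
  have hp₁ : ε * ((ε + ρ ^ 2 * exp (-M)) * T₂) + ρ ^ 2 * exp (-M)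
      ≤ 2 * ε ^ 2 * T₂ + ε * exp (-M) := by
    nlinarith [mul_le_mul_of_nonneg_left hb₁ hε.le]
  have hp₁' : 2 * ε ^ 2 * T₂ + ε * exp (-M) ≤ 2 * T₂ + 1 := by
    nlinarith [mul_le_one₀ hε1 hex0.le hex,
      mul_le_mul_of_nonneg_right (mul_le_one₀ hε1 hε.le hε1) hT₂]
  have hKl : 0 ≤ K / lam := by positivity
  have hin : ε * ((ε + ρ ^ 2 * exp (-M)) * T₂) + ρ ^ 2 * exp (-M) + K
      + ρ ^ 2 * exp (-M) / (lam * ρ ^ 2) + ε⁻¹ * M * ((ε + ρ ^ 2 * exp (-M)) * T₂)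
      ≤ K + 2 * (M + 1) * T₂ + 2 := by nlinarith
  nlinarith [mul_le_mul_of_nonneg_left hin hKl]

/-- **THE ENVELOPE LAW for the knob family (floor form).** Along an exact trajectory of
`rotorCircuit K M ε ρ` from (5.6) with `0 < ρ`, `ρ² ≤ ε ≤ 1`, `M ≥ 0`, `K ≥ 0`: on a window
`[T₁,T₂] ⊆ [0,∞)` on which the trigger over-turns drain and sweep, `c ≥ λρ²` with `λ ≥ max(K,1)`,
and the output has reached `ã ≥ θ₀`, the carrier obeys
`E(t) ≤ 3·exp(-(Kθ₀ - η)(t - T₁))·E(T₁)`, `η = 8ε²T₂ + 4εe^{-M} + (K/λ)(K + 2(M+1)T₂ + 2)`.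
[cite: Tao2016AveragedNS, §5.5 (5.5), (5.6), Theorem 5.3 proof (est), (ob-2)] -/
theorem rotorKnob_carrier_envelope {K M ε ρ : ℝ} {X : ℝ → Fin 5 → ℝ}
    (hX : ∀ t, HasDerivAt X (RotorKnob.rotorCircuit K M ε ρ (X t)) t) (h0 : X 0 = delayInit)
    (hε : 0 < ε) (hε1 : ε ≤ 1) (hρ : 0 < ρ) (hρε : ρ ^ 2 ≤ ε) (hM : 0 ≤ M) (hK : 0 ≤ K)
    {T₁ T₂ lam θ₀ : ℝ} (hT₁ : 0 ≤ T₁) (hlam : 1 ≤ lam) (hKl : K ≤ lam)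
    (hu : ∀ t ∈ Icc T₁ T₂, lam * ρ ^ 2 ≤ X t 2) (he : ∀ t ∈ Icc T₁ T₂, θ₀ ≤ X t 4)
    {t : ℝ} (ht : t ∈ Icc T₁ T₂) :
    X t 0 ^ 2 + X t 3 ^ 2 ≤ 3 * exp (-((K * θ₀ - (8 * ε ^ 2 * T₂ + 4 * ε * exp (-M)
        + K / lam * (K + 2 * (M + 1) * T₂ + 2))) * (t - T₁))) * (X T₁ 0 ^ 2 + X T₁ 3 ^ 2) := by
  rw [RotorKnob.rotorCircuit_eq_fiveGate] at hX
  have hl0 : 0 < lam := by linarith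
  have hσ : 0 ≤ ρ ^ 2 * exp (-M) := by positivity
  have hμ : 0 ≤ ε⁻¹ * M := by positivity
  have hT₂ : 0 ≤ T₂ := hT₁.trans (ht.1.trans ht.2)
  have hb : ∀ r ∈ Icc T₁ T₂, |X r 1| ≤ (ε + ρ ^ 2 * exp (-M)) * T₂ := fun r hr =>
    (abs_b_le hX h0 hε.le hσ (hT₁.trans hr.1)).trans
      (mul_le_mul_of_nonneg_left hr.2 (by positivity))
  have hRc : ∀ r ∈ Icc T₁ T₂, lam ≤ (ρ ^ 2)⁻¹ * X r 2 := fun r hr => by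
    rw [inv_mul_eq_div, le_div_iff₀ (by positivity)]; exact hu r hr
  have h := carrier_envelope_floor hX h0 hε.le hσ hμ hK hT₁ (by positivity : 0 < lam * ρ ^ 2) hl0
    hKl hu hRc hb he ht
  have hη := knob_rate_error_le hε hε1 hρ hρε hM hK hlam hT₂
  have hΔ : 0 ≤ t - T₁ := by linarith [ht.1]
  have hE : 0 ≤ X T₁ 0 ^ 2 + X T₁ 3 ^ 2 := by positivity
  refine h.trans (mul_le_mul_of_nonneg_right (mul_le_mul_of_nonneg_left (exp_le_exp.2 ?_)
    (by norm_num)) hE)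
  nlinarith [mul_le_mul_of_nonneg_right hη hΔ]

/-- **THE ENVELOPE LAW for the knob family (ceiling form).** Same hypotheses with `ã ≤ θ₁` in
place of the floor: `E(t) ≥ ⅓·exp(-(Kθ₁ + η)(t - T₁))·E(T₁)` — the rotor cannot make the drain bite
faster than its average `Kã` either. [cite: Tao2016AveragedNS, §5.5 (5.5), (5.6), Thm 5.3 proof] -/
theorem rotorKnob_carrier_ceiling {K M ε ρ : ℝ} {X : ℝ → Fin 5 → ℝ}
    (hX : ∀ t, HasDerivAt X (RotorKnob.rotorCircuit K M ε ρ (X t)) t) (h0 : X 0 = delayInit)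
    (hε : 0 < ε) (hε1 : ε ≤ 1) (hρ : 0 < ρ) (hρε : ρ ^ 2 ≤ ε) (hM : 0 ≤ M) (hK : 0 ≤ K)
    {T₁ T₂ lam θ₁ : ℝ} (hT₁ : 0 ≤ T₁) (hlam : 1 ≤ lam) (hKl : K ≤ lam)
    (hu : ∀ t ∈ Icc T₁ T₂, lam * ρ ^ 2 ≤ X t 2) (he : ∀ t ∈ Icc T₁ T₂, X t 4 ≤ θ₁)
    {t : ℝ} (ht : t ∈ Icc T₁ T₂) :
    1 / 3 * exp (-((K * θ₁ + (8 * ε ^ 2 * T₂ + 4 * ε * exp (-M)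
        + K / lam * (K + 2 * (M + 1) * T₂ + 2))) * (t - T₁))) * (X T₁ 0 ^ 2 + X T₁ 3 ^ 2)
      ≤ X t 0 ^ 2 + X t 3 ^ 2 := by
  rw [RotorKnob.rotorCircuit_eq_fiveGate] at hX
  have hl0 : 0 < lam := by linarith
  have hσ : 0 ≤ ρ ^ 2 * exp (-M) := by positivity
  have hμ : 0 ≤ ε⁻¹ * M := by positivity
  have hT₂ : 0 ≤ T₂ := hT₁.trans (ht.1.trans ht.2)
  have hb : ∀ r ∈ Icc T₁ T₂, |X r 1| ≤ (ε + ρ ^ 2 * exp (-M)) * T₂ := fun r hr =>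
    (abs_b_le hX h0 hε.le hσ (hT₁.trans hr.1)).trans
      (mul_le_mul_of_nonneg_left hr.2 (by positivity))
  have hRc : ∀ r ∈ Icc T₁ T₂, lam ≤ (ρ ^ 2)⁻¹ * X r 2 := fun r hr => by
    rw [inv_mul_eq_div, le_div_iff₀ (by positivity)]; exact hu r hr
  have h := carrier_envelope_ceiling hX h0 hε.le hσ hμ hK hT₁ (by positivity : 0 < lam * ρ ^ 2) hl0
    hKl hu hRc hb he ht
  have hη := knob_rate_error_le hε hε1 hρ hρε hM hK hlam hT₂
  have hΔ : 0 ≤ t - T₁ := by linarith [ht.1]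
  have hE : 0 ≤ X T₁ 0 ^ 2 + X T₁ 3 ^ 2 := by positivity
  refine le_trans (mul_le_mul_of_nonneg_right (mul_le_mul_of_nonneg_left (exp_le_exp.2 ?_)
    (by norm_num)) hE) h
  nlinarith [mul_le_mul_of_nonneg_right hη hΔ]

end Summit.NavierStokesRegularity.FluidComputer.GateBudget
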